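import Summits.QuantumFields.YangMills.Theorems.VirialFluxGapSharpTwistedLaplaceQuantitativeLaplaceSmooth
import Mathlib.Analysis.InnerProductSpace.Adjoint
import HarnessLib

/-!
# Coercivity from quadratic growth in DECOMPOSED form, and the symmetric operator of a sum-of-squares quadratic form
# (generic front-end lemmas for the assembly (item (d)) of the DIRECT Laplace road to ⟨stmt-QuantumFields-24204⟩ `VirialFluxGap.SharpTwistedLaplace`)

Helper module (free-hands work of width seat ym-line-sfw-p2-w2 g50, cell ym-idea-1; `--supports 24204`).  The phase datum of
✓`QuantitativeLaplace.laplaceMethod_quantitative_orbit_tube` is DECOMPOSED (`f∘σ − f(σ0) = ½⟪Ay,y⟫ + c + r`, `|c| ≤ A₃‖y‖³`, `|r| ≤ A₄‖y‖⁴`), and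
so is the phase model of the ring deficit (✓`ChartPhase.abs_ringDeficit_sub_chartModel_le`: an explicit sum of squares of LINEAR forms minus an odd
cubic, up to `O(‖y‖⁴)`); the coercivity input is the quadratic growth ✓`AnchorSlice.ringDeficit_quadratic_growth_anchorSlice`.  Two generic lemmas
close the gap without any smoothness (compare ✓`coercive_of_quadratic_growth`, which needs `C⁴`):
* ★ `coercive_of_quadratic_growth_decomposed` — if `κ‖y‖² ≤ ½⟪Ay,y⟫ + c(y) + r(y)` on `‖y‖ ≤ R₀` with `|c(y)| ≤ A₃‖y‖³`, `|r(y)| ≤ A₄‖y‖⁴`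
  there, then `2κ‖y‖² ≤ ⟪Ay,y⟫` for EVERY `y` (scale `y ↦ ty`, `t ↓ 0`);
* ★ `isSymmetric_sumSq_operator`, `inner_sumSq_operator` — for finitely many linear maps `s_t : V →ₗ W` between finite-dimensional real
  inner product spaces, `A = Σ_t 2·(s_t† ∘ s_t)` is symmetric and `⟪Ay, y⟫ = 2·Σ_t ‖s_t y‖²`, i.e. `½⟪Ay,y⟫` IS the sum-of-squares form
  (Mathlib `LinearMap.adjoint`).
Everything here is PROVED; no definitions, no named facts (namespace `Summit.QuantumFields.YangMills.Theorems.QuantitativeLaplace`).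

HONEST FRAMING: linear algebra; ⟨24204⟩, ⟨24319⟩, ⟨22884⟩ and every rung stay OPEN; the Yang–Mills mass gap (Clay) is NOT touched; no summit is proved by
a line.

## References
* K. W. Breitung, *Asymptotic Approximations for Probability Integrals*, LNM 1592 (1994), Lemma 7 p. 12. [Breitung1994]
-/

set_option autoImplicit false

noncomputable section

open scoped RealInnerProductSpace BigOperators
open Finset

namespace Summit.QuantumFields.YangMills.Theorems.QuantitativeLaplace

variable {V : Type*} [NormedAddCommGroup V] [InnerProductSpace ℝ V]

/-! ## §1 Coercivity from decomposed quadratic growth -/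

/-- ★ **Coercivity from quadratic growth, decomposed form.**  If `κ‖y‖² ≤ ½⟪Ay,y⟫ + c(y) + r(y)` for `‖y‖ ≤ R₀`, with `|c(y)| ≤ A₃‖y‖³` and
`|r(y)| ≤ A₄‖y‖⁴` there, then `2κ‖y‖² ≤ ⟪Ay,y⟫` for every `y` (no smoothness needed). [cite: Breitung1994, Lemma 7 p. 12] -/
theorem coercive_of_quadratic_growth_decomposed (A : V →ₗ[ℝ] V) {c r : V → ℝ} {κ A₃ A₄ R₀ : ℝ} (hR₀ : 0 < R₀) (hA₃ : 0 ≤ A₃) (hA₄ : 0 ≤ A₄)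
    (hc : ∀ y : V, ‖y‖ ≤ R₀ → |c y| ≤ A₃ * ‖y‖ ^ 3) (hr : ∀ y : V, ‖y‖ ≤ R₀ → |r y| ≤ A₄ * ‖y‖ ^ 4)
    (hgrowth : ∀ y : V, ‖y‖ ≤ R₀ → κ * ‖y‖ ^ 2 ≤ (1 / 2) * ⟪A y, y⟫ + c y + r y) (y : V) :
    2 * κ * ‖y‖ ^ 2 ≤ ⟪A y, y⟫ := by
  by_cases hy : y = 0
  · subst hy; simp
  have hypos : 0 < ‖y‖ := norm_pos_iff.mpr hy
  -- along the ray `t y`, `0 < t ≤ t₀ := min 1 (R₀/‖y‖)`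
  set M : ℝ := A₃ * ‖y‖ ^ 3 + A₄ * ‖y‖ ^ 4 with hM
  have hM0 : 0 ≤ M := by positivity
  have hkey : ∀ t : ℝ, 0 < t → t ≤ 1 → t * ‖y‖ ≤ R₀ → κ * ‖y‖ ^ 2 ≤ (1 / 2) * ⟪A y, y⟫ + t * M := by
    intro t ht ht1 htR
    have hty : ‖t • y‖ = t * ‖y‖ := by rw [norm_smul, Real.norm_eq_abs, abs_of_pos ht]
    have hg := hgrowth (t • y) (by rw [hty]; exact htR)
    have hcb := hc (t • y) (by rw [hty]; exact htR)
    have hrb := hr (t • y) (by rw [hty]; exact htR)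
    rw [hty] at hcb hrb
    rw [map_smul, inner_smul_left, inner_smul_right, hty] at hg
    simp only [RCLike.conj_to_real] at hg
    have hc' : c (t • y) ≤ A₃ * t ^ 3 * ‖y‖ ^ 3 := by have := (abs_le.mp hcb).2; nlinarith [this]
    have hr' : r (t • y) ≤ A₄ * t ^ 4 * ‖y‖ ^ 4 := by have := (abs_le.mp hrb).2; nlinarith [this]
    have ht3 : t ^ 3 ≤ t := by nlinarith [pow_le_pow_left₀ ht.le ht1 2]
    have ht4 : t ^ 4 ≤ t := by nlinarith [pow_le_pow_left₀ ht.le ht1 3]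
    have h1 : κ * (t ^ 2 * ‖y‖ ^ 2) ≤ (1 / 2) * (t ^ 2 * ⟪A y, y⟫) + A₃ * t ^ 3 * ‖y‖ ^ 3 + A₄ * t ^ 4 * ‖y‖ ^ 4 := by
      have e1 : (t * ‖y‖) ^ 2 = t ^ 2 * ‖y‖ ^ 2 := by ring
      have e2 : t * (t * ⟪A y, y⟫) = t ^ 2 * ⟪A y, y⟫ := by ring
      rw [e1, e2] at hg; linarith
    have ht2 : 0 < t ^ 2 := by positivity
    have ht43 : t ^ 4 ≤ t ^ 3 := by nlinarith [pow_nonneg ht.le 3]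
    have h2 : t ^ 2 * (κ * ‖y‖ ^ 2) ≤ t ^ 2 * ((1 / 2) * ⟪A y, y⟫ + t * M) := by
      rw [hM]
      nlinarith [h1, mul_le_mul_of_nonneg_left ht43 (mul_nonneg hA₄ (pow_nonneg hypos.le 4))]
    exact le_of_mul_le_mul_left h2 ht2
  -- let `t ↓ 0`
  have hlim : κ * ‖y‖ ^ 2 ≤ (1 / 2) * ⟪A y, y⟫ := by
    by_contra hcon
    push Not at hcon
    set ε : ℝ := κ * ‖y‖ ^ 2 - (1 / 2) * ⟪A y, y⟫ with hε
    have hε0 : 0 < ε := by linarith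
    -- choose `t = min (min 1 (R₀/‖y‖)) (ε/(2(M+1)))`
    set t : ℝ := min (min 1 (R₀ / ‖y‖)) (ε / (2 * (M + 1))) with ht
    have ht0 : 0 < t := by
      rw [ht]; refine lt_min (lt_min one_pos (div_pos hR₀ hypos)) (by positivity)
    have ht1 : t ≤ 1 := (min_le_left _ _).trans (min_le_left _ _)
    have htR : t * ‖y‖ ≤ R₀ := by
      have : t ≤ R₀ / ‖y‖ := (min_le_left _ _).trans (min_le_right _ _)
      rwa [le_div_iff₀ hypos] at this
    have htε : t * M < ε := by
      have h1 : t ≤ ε / (2 * (M + 1)) := min_le_right _ _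
      have h2 : t * M ≤ ε / (2 * (M + 1)) * M := mul_le_mul_of_nonneg_right h1 hM0
      have h3 : ε / (2 * (M + 1)) * M < ε := by
        rw [div_mul_eq_mul_div, div_lt_iff₀ (by positivity)]; nlinarith
      linarith
    have := hkey t ht0 ht1 htR
    linarith
  linarith

/-! ## §2 The symmetric operator of a sum-of-squares quadratic form -/

section SumSq

variable [FiniteDimensional ℝ V] {W : Type*} [NormedAddCommGroup W] [InnerProductSpace ℝ W] [FiniteDimensional ℝ W]
  {ι : Type*} [Fintype ι]

/-- `A = Σ_t 2·(s_t† ∘ s_t)` is a symmetric operator. [folklore] -/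
theorem isSymmetric_sumSq_operator (s : ι → (V →ₗ[ℝ] W)) :
    (∑ t, (2 : ℝ) • ((LinearMap.adjoint (s t)) ∘ₗ (s t))).IsSymmetric := by
  intro x y
  simp only [LinearMap.coe_sum, Finset.sum_apply, LinearMap.smul_apply, LinearMap.coe_comp, Function.comp_apply, sum_inner, inner_sum,
    inner_smul_left, inner_smul_right, RCLike.conj_to_real]
  refine Finset.sum_congr rfl fun t _ => ?_
  rw [LinearMap.adjoint_inner_left, ← LinearMap.adjoint_inner_right]

/-- `⟪Ay, y⟫ = 2·Σ_t ‖s_t y‖²` for `A = Σ_t 2·(s_t† ∘ s_t)`: `½⟪Ay,y⟫` is the sum-of-squares form. [folklore] -/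
theorem inner_sumSq_operator (s : ι → (V →ₗ[ℝ] W)) (y : V) :
    ⟪(∑ t, (2 : ℝ) • ((LinearMap.adjoint (s t)) ∘ₗ (s t))) y, y⟫ = 2 * ∑ t, ‖s t y‖ ^ 2 := by
  simp only [LinearMap.coe_sum, Finset.sum_apply, LinearMap.smul_apply, LinearMap.coe_comp, Function.comp_apply, sum_inner,
    inner_smul_left, RCLike.conj_to_real]
  rw [Finset.mul_sum]
  refine Finset.sum_congr rfl fun t _ => ?_
  rw [LinearMap.adjoint_inner_left, real_inner_self_eq_norm_sq]

end SumSq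

end Summit.QuantumFields.YangMills.Theorems.QuantitativeLaplace
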